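import Summits.HodgeConjecture.CorCM.MultiFieldWeilPrimeDegreesOutsideClosures
import Summits.HodgeConjecture.CorCM.MultiFieldWeilNonIsomorphicGroupBlocks
import HarnessLib

/-!
# MULTI-FIELD WEIL ENGINE — ANY NUMBER OF SIMPLE CM THREEFOLDS OVER PAIRWISE NON-ISOMORPHIC SEXTIC CM FIELDS SHARING `k`:
# simple form, curve-free form, group blocks, separated groups with surfaces and curves — given ONLY Markman's fourfold theorem

Cell `pub-hodgecm2` (COR-CM), seat b30 gen 36 (2026-08-25); count-neutral own lane MULTI-FIELD WEIL ENGINE (stem `MultiFieldWeil*`), the consumers of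
`CorCM/MultiFieldWeilPrimeDegreesOutsideClosures.lean` (W1 §3: sextic CM fields through `k` without homomorphisms between them lie outside each other's Galois
closures) on the statements of `CorCM/MultiFieldWeilNonIsomorphicSimpleFamilies.lean` (V3) and `CorCM/MultiFieldWeilNonIsomorphicGroupBlocks.lean` (V4), whose
closure hypothesis `hout` is thereby replaced by the field-theoretic **`Hom(K_m, K_{m₀}) = ∅` for `m₀ ≠ m`** (pairwise non-isomorphic sextic fields).  Theorems only;
no definition, no named fact, no `sorry`.  HONEST FRAMING: conditional ONLY on `Markman2025_weilClasses_algebraic_abelianFourfold` (and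
`Markman2025_weilClasses_algebraic_hyperbolicSixfold` where decic slots occur); `HC_CM` is NOT proved and not asserted.

* §0 `exists_apply_not_mem_normalClosure_of_isEmpty_ringHom_of_quadratic` — W1 §3 for a family `K : I → Type` and a standalone imaginary quadratic `k`
  (`k ↪ K_t`, `k ↪ K_{t'}` sextic CM, `Hom(K_t, K_{t'}) = ∅` ⟹ every embedding of `K_t` over `τ` takes a value outside `L(K_{t'})`).
* §1 **`hodgeConjectureFor_biproduct_comp_of_simpleThreefolds_of_isEmpty_ringHom`**: `E = A 0 ⊨ (k; {τ})`, `T_m = A (m+1)` SIMPLE CM threefolds over SEXTIC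
  `K_m ⊇ i_m(k)` with `Hom(K_m, K_{m₀}) = ∅` (`m₀ ≠ m`): HC for EVERY product of copies, mod Markman 4 (V3 §1); and V3 §2 (simple threefolds + Weil-type fivefolds)
  from ONE value outside each other's closure instead of `hST` (`…_weilFivefolds_of_outside_closures`, W1 §1c).
* §2 **`hodgeConjectureFor_biproduct_comp_of_simpleThreefolds_of_isEmpty_ringHom_curveFree`**: no curve in the statement (V3 §3).
* §3 **`hodgeConjectureFor_prod_groupBlock_of_isEmpty_ringHom`** (uniform family: the threefolds through `k` with pairwise `Hom = ∅` + the curves through their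
  fields) and the MAIN THEOREM **`hodgeConjectureFor_prod_of_separatedGroups_of_isEmpty_ringHom`**: `A_i ⊨ (K_i; Φ_i)` simple of dimension `≤ 3`, labels
  `b : I → C`, the threefolds of each label over sextic fields through `k_c` PAIRWISE WITHOUT HOMOMORPHISMS, differently labelled sextic slots SEPARATED, simple
  surfaces with (iii′), any CM elliptic curves ⟹ HC for every product of copies, mod Markman 4 (V4 §2).

What remains open inside one imaginary quadratic field `k` is exactly seat b16's (ii′): several NON-ISOGENOUS threefolds over ISOMORPHIC sextic fields (beyond
the pair, `N5`); across different `k`, the sister coincidences; among surfaces, the dihedral triple.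

[cite: Markman2025SurveySecant, Thm. 1.2] [cite: Markman2025SecantWeil, Thm 1.5.1] [cite: Dodson1984, §5.1.2 Theorem] [cite: Lang2002, V §1 Prop. 1.2, VI §1 Thm. 1.1 and Cor. 1.6]
[cite: Shimura1998, §8.2 Prop. 26, §18.2 Lemma (i)] [cite: MoonenZarhin1999LowDim, Thm. (0.1), Thm. (0.2), §3 (3.1)] [cite: MumfordAV1970, §19]

## References
* [Markman2025SurveySecant] E. Markman, arXiv:2509.23403, Thm. 1.2.  [Markman2025SecantWeil] E. Markman, Cycles on abelian 2n-folds of Weil type from secant sheaves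
  on abelian n-folds, Thm 1.5.1.  [Dodson1984] B. Dodson, Trans. AMS 283 (1984), §5.1.2.  [Lang2002] S. Lang, *Algebra*, GTM 211, V §1, VI §1.  [Shimura1998]
  G. Shimura, *Abelian varieties with complex multiplication and modular functions*, §8.2, §18.2.  [MoonenZarhin1999LowDim] B. Moonen, Yu. Zarhin, Math. Ann.
  315 (1999).  [MumfordAV1970] D. Mumford, *Abelian Varieties*, §19.
-/

noncomputable section

open CategoryTheory CategoryTheory.Limits NumberField IntermediateField

namespace Summit.HodgeConjecture.CorCM.MultiFieldWeil

open Finset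
open Literature.AlgebraicGeometry Literature.AlgebraicGeometry.Motives Literature.AlgebraicGeometry.HodgeTheory
open Literature.AlgebraicGeometry.ComplexMultiplication (IsCMTypeRealisation)
open Literature.AlgebraicTopology.SingularHomology
open Literature.NumberTheory.ComplexMultiplication

open scoped Classical

/-! ## §0 The closure lemma for a family of fields and a standalone imaginary quadratic field -/

section Closure

variable {I : Type} {K : I → Type} [∀ i, Field (K i)] [∀ i, NumberField (K i)] [∀ i, IsCMField (K i)]
  {k : Type} [Field k] [NumberField k] [IsTotallyComplex k]

/-- **Non-isomorphic sextic CM fields through `k` lie outside each other's Galois closures** (family form of W1 §3): `k` imaginary quadratic with `i : k ↪ K_t`,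
`i' : k ↪ K_{t'}`, both SEXTIC CM, `Hom(K_t, K_{t'}) = ∅`; then every embedding `s` of `K_t` over `τ` takes a value outside `normalClosure ℚ (K_{t'}) ℂ` (else a
subfield of degree `18` inside one of degree `6` or `12`). [cite: Dodson1984, §5.1.2 Theorem] [cite: Lang2002, V §1 Prop. 1.2 and VI §1 Thm. 1.1] -/
theorem exists_apply_not_mem_normalClosure_of_isEmpty_ringHom_of_quadratic (h2 : Module.finrank ℚ k = 2) {t t' : I} (h6 : Module.finrank ℚ (K t) = 6)
    (h6' : Module.finrank ℚ (K t') = 6) (i : k →+* K t) (i' : k →+* K t') (hK : IsEmpty (K t →+* K t')) (τ : k →+* ℂ) (s : K t →+* ℂ)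
    (hs : s.comp i = τ) : ∃ x, s x ∉ normalClosure ℚ (K t') ℂ := by
  by_contra hall
  push Not at hall
  obtain ⟨u, hu⟩ : ∃ u : K t' →+* ℂ, u.comp i' = τ := by
    have hc := SexticOcticWeil.card_filter_comp_eq_of_finrank (n := 3) i' (by rw [h6']) h2 τ
    obtain ⟨u, hu⟩ := Finset.card_pos.1 (by rw [hc]; exact Nat.succ_pos 2)
    exact ⟨u, (Finset.mem_filter.1 hu).2⟩
  have hle : adjoin ℚ (Set.range τ) ⊔ adjoin ℚ (Set.range u ∪ Set.range s) ≤ normalClosure ℚ (K t') ℂ := by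
    refine sup_le (adjoin_le_iff.2 ?_) (adjoin_le_iff.2 ?_)
    · rintro _ ⟨y, rfl⟩
      rw [← hu]
      exact ringHom_apply_mem_normalClosure u _
    · rintro _ (⟨y, rfl⟩ | ⟨y, rfl⟩)
      exacts [ringHom_apply_mem_normalClosure u y, hall y]
  have h18 : Module.finrank ℚ ↥(adjoin ℚ (Set.range τ) ⊔ adjoin ℚ (Set.range u ∪ Set.range s)) = 9 * Module.finrank ℚ k :=
    finrank_adjoin_pair_of_isEmpty_ringHom i' i (by rw [h6', h2]) (by rw [h6, h2]) hK hu hs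
  have hM := finrank_normalClosure_of_quadratic (K := K) h6' h2 i'
  have hle' := IntermediateField.finrank_le_of_le_right hle
  rw [h18, h2] at hle'
  rcases hM with h | h <;> rw [h] at hle' <;> norm_num at hle'

end Closure

/-! ## §1 The engine family: simple threefolds over pairwise non-isomorphic sextic fields through `k` -/

section Engine

variable {I : Type} {r : ℕ} {Kf : I → Type} [∀ i, Field (Kf i)] [∀ i, NumberField (Kf i)] [∀ i, IsCMField (Kf i)]
  {i₀ : I} {is : Fin r → I} {τ : Kf i₀ →+* ℂ}
  {A : Fin (r + 1) → AbelianVariety ℂ} {Φ : ∀ j : Fin (r + 1), CMType (Kf (mfSlots i₀ is j))}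
  {ι : ∀ j, 𝓞 (Kf (mfSlots i₀ is j)) →+* End (A j)}
  {θ : ∀ j, Kf (mfSlots i₀ is j) →+* Module.End ℂ (complexBetti (A j).X 1)}

/-- **ANY NUMBER OF SIMPLE CM THREEFOLDS OVER PAIRWISE NON-ISOMORPHIC SEXTIC CM FIELDS THROUGH `k` — given ONLY Markman's fourfold theorem; no tower, no closure
hypothesis.**  `E = A 0 ⊨ (k; {τ})`, `k = Kf i₀` imaginary quadratic; `T_m = A (m+1) ⊨ (K_m; Φ (m+1))` SIMPLE abelian threefolds over SEXTIC `K_m = Kf (is m) ⊇ i_m(k)` — nothing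
assumed on the types —, with NO ring homomorphism `K_m → K_{m₀}` for `m₀ ≠ m`.  Then the Hodge conjecture holds for EVERY product of copies `⨁_j A (κ j)`.  `HC_CM` is NOT
asserted. [cite: Markman2025SurveySecant, Thm. 1.2] [cite: Shimura1998, §8.2 Prop. 26, §18.2 Lemma (i)] [cite: Dodson1984, §5.1.2 Theorem] -/
theorem hodgeConjectureFor_biproduct_comp_of_simpleThreefolds_of_isEmpty_ringHom (hW4 : Markman2025_weilClasses_algebraic_abelianFourfold)
    {N : ℕ} (κ : Fin N → Fin (r + 1)) (h2 : Module.finrank ℚ (Kf i₀) = 2) (h6 : ∀ m : Fin r, Module.finrank ℚ (Kf (is m)) = 6)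
    (im : ∀ m : Fin r, Kf i₀ →+* Kf (is m)) (hA : ∀ j, IsCMTypeRealisation (Φ j) (A j) (ι j) (θ j)) (hΨ : ∀ σ : Kf i₀ →+* ℂ, σ ∈ (Φ 0).1 ↔ σ = τ)
    (hS : ∀ m : Fin r, (A m.succ).IsSimple) (hiso : ∀ (m₀ m : Fin r), m₀ ≠ m → IsEmpty (Kf (is m) →+* Kf (is m₀))) :
    HodgeConjectureFor (⨁ fun j => A (κ j)).dim (⨁ fun j => A (κ j)).X :=
  hodgeConjectureFor_biproduct_comp_of_simpleThreefolds_of_outside_closures hW4 κ h2 h6 im hA hΨ hS (outside_closures_of_pairwise_isEmpty_ringHom h2 h6 im hiso)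

/-- **Dominated form.** [cite: Markman2025SurveySecant, Thm. 1.2] [cite: MumfordAV1970, §19 Thm. 1 and p. 169] -/
theorem hodgeConjectureFor_of_avDominatedBy_comp_of_simpleThreefolds_of_isEmpty_ringHom (hW4 : Markman2025_weilClasses_algebraic_abelianFourfold)
    {N : ℕ} (κ : Fin N → Fin (r + 1)) (h2 : Module.finrank ℚ (Kf i₀) = 2) (h6 : ∀ m : Fin r, Module.finrank ℚ (Kf (is m)) = 6)
    (im : ∀ m : Fin r, Kf i₀ →+* Kf (is m)) (hA : ∀ j, IsCMTypeRealisation (Φ j) (A j) (ι j) (θ j)) (hΨ : ∀ σ : Kf i₀ →+* ℂ, σ ∈ (Φ 0).1 ↔ σ = τ)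
    (hS : ∀ m : Fin r, (A m.succ).IsSimple) (hiso : ∀ (m₀ m : Fin r), m₀ ≠ m → IsEmpty (Kf (is m) →+* Kf (is m₀)))
    {X : AbelianVariety ℂ} (hX : Domination.AVDominatedBy X (⨁ fun j => A (κ j))) : HodgeConjectureFor X.dim X.X :=
  Domination.hodgeConjectureFor_of_avDominatedBy (hodgeConjectureFor_biproduct_comp_of_simpleThreefolds_of_isEmpty_ringHom hW4 κ h2 h6 im hA hΨ hS hiso) hX

/-- **SIMPLE CM THREEFOLDS (sextic) AND WEIL-TYPE CM FIVEFOLDS (decic, `k`-signature `(2,3)` ∕ `(3,2)`) SHARING `k`, EACH WITH A `τ`-EMBEDDING TAKING A VALUE OUTSIDE THE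
GALOIS CLOSURE OF EACH OTHER — given Markman's fourfold and hyperbolic-sixfold theorems; no tower, no `hST`.**  `n m ∈ {3, 5}`, `[K_m : ℚ] = 2 n_m`; sextic slots carry SIMPLE
threefolds, decic slots carry types with two or three members over `τ`; for `m₀ ≠ m` SOME `τ`-embedding of `K_m` takes SOME value outside `normalClosure ℚ (K_{m₀}) ℂ` (W1
§1c supplies `hST`).  Then the Hodge conjecture holds for EVERY product of copies `⨁_j A (κ j)`.  `HC_CM` is NOT asserted. [cite: Markman2025SurveySecant, Thm. 1.2]
[cite: Markman2025SecantWeil, Thm 1.5.1] [cite: Shimura1998, §8.2 Prop. 26, §18.2 Lemma (i)] -/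
theorem hodgeConjectureFor_biproduct_comp_of_simpleThreefolds_weilFivefolds_of_outside_closures (hW4 : Markman2025_weilClasses_algebraic_abelianFourfold)
    (hM6 : Markman2025_weilClasses_algebraic_hyperbolicSixfold) (n : Fin r → ℕ) (hn : ∀ m, n m = 3 ∨ n m = 5)
    {N : ℕ} (κ : Fin N → Fin (r + 1)) (h2 : Module.finrank ℚ (Kf i₀) = 2) (hdeg : ∀ m : Fin r, Module.finrank ℚ (Kf (is m)) = 2 * n m)
    (im : ∀ m : Fin r, Kf i₀ →+* Kf (is m)) (hA : ∀ j, IsCMTypeRealisation (Φ j) (A j) (ι j) (θ j)) (hΨ : ∀ σ : Kf i₀ →+* ℂ, σ ∈ (Φ 0).1 ↔ σ = τ)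
    (hS : ∀ m : Fin r, n m = 3 → (A m.succ).IsSimple)
    (h23 : ∀ m : Fin r, n m = 5 → (Finset.univ.filter fun s : Kf (is m) →+* ℂ => s.comp (im m) = τ ∧ s ∈ (Φ m.succ).1).card = 2 ∨
      (Finset.univ.filter fun s : Kf (is m) →+* ℂ => s.comp (im m) = τ ∧ s ∈ (Φ m.succ).1).card = 3)
    (hout : ∀ (m₀ m : Fin r), m₀ ≠ m → ∃ s : Kf (is m) →+* ℂ, s.comp (im m) = τ ∧ ∃ x, s x ∉ normalClosure ℚ (Kf (is m₀)) ℂ) :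
    HodgeConjectureFor (⨁ fun j => A (κ j)).dim (⨁ fun j => A (κ j)).X :=
  hodgeConjectureFor_biproduct_comp_of_simpleThreefolds_weilFivefolds_of_stabiliserTransitive hW4 hM6 n hn κ h2 hdeg im hA hΨ hS h23
    (stabiliserTransitive_of_outside_primes h2 hdeg im (fun m => by rcases hn m with h | h <;> rw [h] <;> norm_num) hout)

end Engine

/-! ## §2 No curve in the statement -/

section CurveFree

variable {I : Type} {r : ℕ} {Kf : I → Type} [∀ i, Field (Kf i)] [∀ i, NumberField (Kf i)] [∀ i, IsCMField (Kf i)]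
  {i₀ : I} {is : Fin r → I}
  {T : Fin r → AbelianVariety ℂ} {ΦT : ∀ m : Fin r, CMType (Kf (is m))}
  {ιT : ∀ m, 𝓞 (Kf (is m)) →+* End (T m)} {θT : ∀ m, Kf (is m) →+* Module.End ℂ (complexBetti (T m).X 1)}

/-- **ANY NUMBER OF SIMPLE CM THREEFOLDS WHOSE SEXTIC CM FIELDS CONTAIN `k` AND ARE PAIRWISE NON-ISOMORPHIC — given ONLY Markman's fourfold theorem; no curve in the
statement.**  `k = Kf i₀` imaginary quadratic with a chosen complex embedding `τ`; `T_m ⊨ (K_m; ΦT m)` (`m < r`) SIMPLE abelian threefolds with CM by SEXTIC `K_m = Kf (is m) ⊇ i_m(k)`,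
nothing assumed on the types, `Hom(K_m, K_{m₀}) = ∅` for `m₀ ≠ m`.  Then for every `κ : Fin N → Fin r` the Hodge conjecture holds for `⨁_j T (κ j)` — EVERY
`T_0^{b_0} × ⋯ × T_{r−1}^{b_{r−1}}`.  `HC_CM` is NOT asserted. [cite: Markman2025SurveySecant, Thm. 1.2] [cite: Shimura1998, §6.2 Thm. 3, §8.2 Prop. 26, §18.2 Lemma (i)]
[cite: Dodson1984, §5.1.2 Theorem] -/
theorem hodgeConjectureFor_biproduct_comp_of_simpleThreefolds_of_isEmpty_ringHom_curveFree (hW4 : Markman2025_weilClasses_algebraic_abelianFourfold)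
    {N : ℕ} (κ : Fin N → Fin r) (h2 : Module.finrank ℚ (Kf i₀) = 2) (h6 : ∀ m : Fin r, Module.finrank ℚ (Kf (is m)) = 6)
    (im : ∀ m : Fin r, Kf i₀ →+* Kf (is m)) (hT : ∀ m, IsCMTypeRealisation (ΦT m) (T m) (ιT m) (θT m)) (hS : ∀ m, (T m).IsSimple) (τ : Kf i₀ →+* ℂ)
    (hiso : ∀ (m₀ m : Fin r), m₀ ≠ m → IsEmpty (Kf (is m) →+* Kf (is m₀))) :
    HodgeConjectureFor (⨁ fun j => T (κ j)).dim (⨁ fun j => T (κ j)).X :=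
  hodgeConjectureFor_biproduct_comp_of_simpleThreefolds_of_outside_closures_curveFree hW4 κ h2 h6 im hT hS τ
    (outside_closures_of_pairwise_isEmpty_ringHom h2 h6 im hiso)

/-- **Dominated form.** [cite: Markman2025SurveySecant, Thm. 1.2] [cite: MumfordAV1970, §19 Thm. 1 and p. 169] -/
theorem hodgeConjectureFor_of_avDominatedBy_comp_of_simpleThreefolds_of_isEmpty_ringHom_curveFree (hW4 : Markman2025_weilClasses_algebraic_abelianFourfold)
    {N : ℕ} (κ : Fin N → Fin r) (h2 : Module.finrank ℚ (Kf i₀) = 2) (h6 : ∀ m : Fin r, Module.finrank ℚ (Kf (is m)) = 6)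
    (im : ∀ m : Fin r, Kf i₀ →+* Kf (is m)) (hT : ∀ m, IsCMTypeRealisation (ΦT m) (T m) (ιT m) (θT m)) (hS : ∀ m, (T m).IsSimple) (τ : Kf i₀ →+* ℂ)
    (hiso : ∀ (m₀ m : Fin r), m₀ ≠ m → IsEmpty (Kf (is m) →+* Kf (is m₀)))
    {X : AbelianVariety ℂ} (hX : Domination.AVDominatedBy X (⨁ fun j => T (κ j))) : HodgeConjectureFor X.dim X.X :=
  Domination.hodgeConjectureFor_of_avDominatedBy
    (hodgeConjectureFor_biproduct_comp_of_simpleThreefolds_of_isEmpty_ringHom_curveFree hW4 κ h2 h6 im hT hS τ hiso) hX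

end CurveFree

/-! ## §3 Uniform families: the group block and the separated groups, with `Hom = ∅` inside each group -/

section Family

variable {I : Type} [Fintype I] {K : I → Type} [fK : ∀ i, Field (K i)] [nK : ∀ i, NumberField (K i)] [cK : ∀ i, IsCMField (K i)]
  {Φ : ∀ i, CMType (K i)} {A : I → AbelianVariety ℂ} {ι : ∀ i, 𝓞 (K i) →+* End (A i)} {θ : ∀ i, K i →+* Module.End ℂ (complexBetti (A i).X 1)}
  {C : Type}

omit [Fintype I] in
/-- **THE GROUP BLOCK, `Hom = ∅` FORM.**  `A_i ⊨ (K_i; Φ_i)` simple; `e : Fin r → I` SEXTIC slots through the imaginary quadratic field `k` (`i m : k ↪ K_{e m}`) with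
`Hom(K_{e m}, K_{e m₀}) = ∅` for `m₀ ≠ m`; a product of copies every member of which is some `A_{e m}` or a CM elliptic curve whose field embeds in some `K_{e m}`.  Then
the Hodge conjecture holds for it, GIVEN ONLY Markman's fourfold theorem (V4 §1 with §0). [cite: Markman2025SurveySecant, Thm. 1.2]
[cite: Shimura1998, §6.1 Corollary of Theorem 2, §18.2 Lemma (i)] [cite: Dodson1984, §5.1.2 Theorem] -/
theorem hodgeConjectureFor_prod_groupBlock_of_isEmpty_ringHom (hW4 : Markman2025_weilClasses_algebraic_abelianFourfold)
    (hA : ∀ i, IsCMTypeRealisation (Φ i) (A i) (ι i) (θ i)) (hS : ∀ i, (A i).IsSimple) {r : ℕ} (e : Fin r → I) (h6 : ∀ m, Module.finrank ℚ (K (e m)) = 6)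
    {k : Type} [Field k] [NumberField k] [IsCMField k] (h2 : Module.finrank ℚ k = 2) (i : ∀ m, k →+* K (e m)) (τ : k →+* ℂ)
    (hiso : ∀ m₀ m : Fin r, m₀ ≠ m → IsEmpty (K (e m) →+* K (e m₀)))
    {M : ℕ} (ρ : Fin M → I) (hρ : ∀ l, (Module.finrank ℚ (K (ρ l)) = 2 ∧ ∃ m, Nonempty (K (ρ l) →+* K (e m))) ∨ ∃ m, ρ l = e m) :
    HodgeConjectureFor (⨁ fun l => A (ρ l)).dim (⨁ fun l => A (ρ l)).X :=
  hodgeConjectureFor_prod_groupBlock_of_outside_closures hW4 hA hS e h6 h2 i τ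
    (fun m₀ m hm s hs => exists_apply_not_mem_normalClosure_of_isEmpty_ringHom_of_quadratic h2 (h6 m) (h6 m₀) (i m) (i m₀) (hiso m₀ m hm) τ s hs) ρ hρ

variable {r : C → ℕ} {kc : C → Type} [∀ c, Field (kc c)] [∀ c, NumberField (kc c)] [∀ c, IsCMField (kc c)]

/-- **MAIN THEOREM — SEPARATED GROUPS OF SIMPLE CM THREEFOLDS, EACH GROUP THROUGH ONE IMAGINARY QUADRATIC FIELD WITH PAIRWISE NON-ISOMORPHIC FIELDS; SURFACES UP TO THE
DIHEDRAL-TRIPLE LIMIT; ANY CURVES — given ONLY Markman's fourfold theorem.**  `A_i ⊨ (K_i; Φ_i)` (`i ∈ I` finite) SIMPLE of dimension `≤ 3`; `b : I → C`; for each label `c`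
the sextic slots of label `c` are among `e_c : Fin r_c → I` with `K_{e_c m} ⊇ i_c m (k_c)` and `Hom(K_{e_c m}, K_{e_c m₀}) = ∅` for `m₀ ≠ m`; differently labelled sextic slots
SEPARATED (different Galois closures, no totally complex quadratic subfield of one embedding in the other); (iii′) among any three quartic slots with one Galois closure two
carry isogenous surfaces; any quadratic slots.  Then the Hodge conjecture holds for every product of copies `⨁_j A_{π j}`.  `HC_CM` is NOT asserted.
[cite: MoonenZarhin1999LowDim, Thm. (0.1), Thm. (0.2), §3 (3.1), Cor. (3.9)] [cite: Markman2025SurveySecant, Thm. 1.2] [cite: Dodson1984, §5.1.2 Theorem] -/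
theorem hodgeConjectureFor_prod_of_separatedGroups_of_isEmpty_ringHom (hW4 : Markman2025_weilClasses_algebraic_abelianFourfold)
    (hA : ∀ i, IsCMTypeRealisation (Φ i) (A i) (ι i) (θ i)) (hS : ∀ i, (A i).IsSimple) (h3 : ∀ i, (A i).dim ≤ 3) (b : I → C)
    (hsep : ∀ t t', Module.finrank ℚ (K t) = 6 → Module.finrank ℚ (K t') = 6 → b t ≠ b t' →
      normalClosure ℚ (K t) ℂ ≠ normalClosure ℚ (K t') ℂ ∧ ¬ ∃ F : IntermediateField ℚ (K t), Module.finrank ℚ F = 2 ∧ IsTotallyComplex F ∧ Nonempty (F →+* K t'))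
    (e : ∀ c, Fin (r c) → I) (h6 : ∀ c m, Module.finrank ℚ (K (e c m)) = 6) (hcov : ∀ t, Module.finrank ℚ (K t) = 6 → ∃ m, t = e (b t) m)
    (h2c : ∀ c, Module.finrank ℚ (kc c) = 2) (i : ∀ c m, kc c →+* K (e c m)) (τ : ∀ c, kc c →+* ℂ)
    (hiso : ∀ c (m₀ m : Fin (r c)), m₀ ≠ m → IsEmpty (K (e c m) →+* K (e c m₀)))
    (hS3 : ∀ x y z : I, Module.finrank ℚ (K x) = 4 → Module.finrank ℚ (K y) = 4 → Module.finrank ℚ (K z) = 4 →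
      normalClosure ℚ (K x) ℂ = normalClosure ℚ (K y) ℂ → normalClosure ℚ (K y) ℂ = normalClosure ℚ (K z) ℂ →
      AbelianVariety.IsIsogenous (A x) (A y) ∨ AbelianVariety.IsIsogenous (A x) (A z) ∨ AbelianVariety.IsIsogenous (A y) (A z))
    {N : ℕ} (π : Fin N → I) : HodgeConjectureFor (⨁ fun j => A (π j)).dim (⨁ fun j => A (π j)).X :=
  hodgeConjectureFor_prod_of_separatedGroups_of_outside_closures hW4 hA hS h3 b hsep e h6 hcov h2c i τ
    (fun c m₀ m hm s hs => exists_apply_not_mem_normalClosure_of_isEmpty_ringHom_of_quadratic (h2c c) (h6 c m) (h6 c m₀) (i c m) (i c m₀) (hiso c m₀ m hm)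
      (τ c) s hs) hS3 π

/-- **Dominated form.** [cite: MoonenZarhin1999LowDim, Thm. (0.1), (0.2)] [cite: Markman2025SurveySecant, Thm. 1.2] [cite: MumfordAV1970, §19 Thm. 1 and p. 169] -/
theorem hodgeConjectureFor_of_avDominatedBy_prod_of_separatedGroups_of_isEmpty_ringHom (hW4 : Markman2025_weilClasses_algebraic_abelianFourfold)
    (hA : ∀ i, IsCMTypeRealisation (Φ i) (A i) (ι i) (θ i)) (hS : ∀ i, (A i).IsSimple) (h3 : ∀ i, (A i).dim ≤ 3) (b : I → C)
    (hsep : ∀ t t', Module.finrank ℚ (K t) = 6 → Module.finrank ℚ (K t') = 6 → b t ≠ b t' →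
      normalClosure ℚ (K t) ℂ ≠ normalClosure ℚ (K t') ℂ ∧ ¬ ∃ F : IntermediateField ℚ (K t), Module.finrank ℚ F = 2 ∧ IsTotallyComplex F ∧ Nonempty (F →+* K t'))
    (e : ∀ c, Fin (r c) → I) (h6 : ∀ c m, Module.finrank ℚ (K (e c m)) = 6) (hcov : ∀ t, Module.finrank ℚ (K t) = 6 → ∃ m, t = e (b t) m)
    (h2c : ∀ c, Module.finrank ℚ (kc c) = 2) (i : ∀ c m, kc c →+* K (e c m)) (τ : ∀ c, kc c →+* ℂ)
    (hiso : ∀ c (m₀ m : Fin (r c)), m₀ ≠ m → IsEmpty (K (e c m) →+* K (e c m₀)))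
    (hS3 : ∀ x y z : I, Module.finrank ℚ (K x) = 4 → Module.finrank ℚ (K y) = 4 → Module.finrank ℚ (K z) = 4 →
      normalClosure ℚ (K x) ℂ = normalClosure ℚ (K y) ℂ → normalClosure ℚ (K y) ℂ = normalClosure ℚ (K z) ℂ →
      AbelianVariety.IsIsogenous (A x) (A y) ∨ AbelianVariety.IsIsogenous (A x) (A z) ∨ AbelianVariety.IsIsogenous (A y) (A z))
    {N : ℕ} (π : Fin N → I) {X : AbelianVariety ℂ} (hX : Domination.AVDominatedBy X (⨁ fun j => A (π j))) : HodgeConjectureFor X.dim X.X :=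
  Domination.hodgeConjectureFor_of_avDominatedBy
    (hodgeConjectureFor_prod_of_separatedGroups_of_isEmpty_ringHom hW4 hA hS h3 b hsep e h6 hcov h2c i τ hiso hS3 π) hX

end Family

end Summit.HodgeConjecture.CorCM.MultiFieldWeil

end
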